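import Summits.ValiantsHypothesis.ValiantsHypothesis.Theorems.MonotoneRestorationOrbitRestorationQPBoxVolumeMultiset
import Summits.ValiantsHypothesis.ValiantsHypothesis.Theorems.MonotoneRestorationOrbitRestorationQPCatalecticantRestoration
import HarnessLib

/-!
# Route MonotoneRestoration — crux `OrbitRestorationQP` (stmt-ValiantsHypothesis-18293), line `depth-three-rung`:
# THE CATALECTICANT / BOX-VOLUME STRATUM OF `A_∞` NEEDS ONLY DIAGONAL INVARIANCE (per level, uniform constant)

The landed catalecticant and box-volume strata (`DerivativeTower.smallGradedDerivChain_restoration`,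
`catalecticant_restoration`, `boxVolume_restoration'`, and the per-level form `Residue.qpOrbitRestorable_of_smallBox`) are
typed with MATRIX symmetry (`IsMatrixSymmetric`, independent row and column permutations).  Their engine, however — the
alternating-fixed-vector theorem `AltFix.smallModules_altSpanning` and the graded system
`DerivativeTowerAlt.qpOrbitRestorable_of_gradedSystem` — is a statement about the DIAGONAL action only.  This file re-runs the
(short) assembly with diagonal invariance `∀ ρ, ren ρ p = p` in place of matrix symmetry:

* `mact_mem_derivChain_of_fixed` — the derivative chain of `f` is stable under ONE matrix renaming fixing `f`
  (the tree's `mact_mem_derivChain` asks for all of them);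
* `qpOrbitRestorable_of_smallGradedDerivChain_diag`, `smallGradedDerivChain_restoration_diag`,
  `catalecticant_restoration_diag`, `boxVolume_restoration_diag` — the diagonal versions (family forms, one constant per `c`);
* `qpOrbitRestorable_of_smallBox_diag` — **PER LEVEL**: for every `c` there is `c'` such that every DIAGONALLY INVARIANT `p` at
  level `n` with a depth-three representation `p = Σ_{i<k} C(a i) · Π (L i)` (affine factors) of total box volume `≤ n^c + c` is
  `QPOrbitRestorable c' n p`.

Use: in the grouped criterion of `…OrbitRestorationQPGroupedTerms.lean` the kind (B) groups may be taken diagonally invariant only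
(like the tame kind (T)); group sums inside a matrix-symmetric representation are typically only diagonally invariant.
Everything is proved; the stub A_∞ stays open; VP ≠ VNP is not touched. [folklore]

## References
* A. Dawar, G. Wilsenach, *Symmetric arithmetic circuits*, ToC 21 (2025), §3.3. [DawarWilsenach2025]
-/

noncomputable section

open scoped Classical

-- `Summit.ValiantsHypothesis.ValiantsHypothesis.…` is the tree's single-conjunct layout (Sub = Summit).
set_option linter.dupNamespace false

namespace Summit.ValiantsHypothesis.ValiantsHypothesis.Theorems

namespace DerivativeTower

open MvPolynomial Finset Equiv OrbitRestorationQPDepthThreeRung WaringJennrich LevelStructure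

variable {n : ℕ}

/-! ### Stability of the derivative chain under one renaming -/

/-- **The derivative chain of `f` is stable under a matrix renaming fixing `f`** (one `(σ, τ)` at a time).
[folklore] -/
theorem mact_mem_derivChain_of_fixed {f : MvPolynomial (Fin n × Fin n) ℂ} {σ τ : Perm (Fin n)} (hsym : mact σ τ f = f) :
    ∀ (m : ℕ) {p : MvPolynomial (Fin n × Fin n) ℂ}, p ∈ derivChain f m → mact σ τ p ∈ derivChain f m
  | 0, p, hp => by
      rw [derivChain, Submodule.mem_span_singleton] at hp ⊢
      obtain ⟨c, rfl⟩ := hp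
      exact ⟨c, by rw [map_smul, hsym]⟩
  | m + 1, p, hp => by
      have hmap : (derivChain f (m + 1)).map (mact σ τ).toLinearEquiv.toLinearMap ≤ derivChain f (m + 1) := by
        rw [derivChain, Submodule.map_span_le]
        rintro _ ⟨x, q, hq, rfl⟩
        show mact σ τ (pderiv x q) ∈ _
        rw [mact_pderiv]
        exact Submodule.subset_span ⟨(σ x.1, τ x.2), mact σ τ q, mact_mem_derivChain_of_fixed hsym m hq, rfl⟩
      exact hmap (Submodule.mem_map_of_mem hp)

/-! ### Graded catalecticant rank, diagonal form -/

/-- **GRADED POLYNOMIAL CATALECTICANT RANK ⇒ ORBIT-RESTORABLE, DIAGONAL FORM (modulo the alt-spanning property for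
diagonally stable spaces).**  As `qpOrbitRestorable_of_smallGradedDerivChain`, with `f` only DIAGONALLY invariant and the key
asked for diagonally stable subspaces (which is what `AltFix.smallModules_altSpanning` provides). [folklore] -/
theorem qpOrbitRestorable_of_smallGradedDerivChain_diag {k r D : ℕ}
    (hKey : ∀ W : Submodule ℂ (MvPolynomial (Fin n × Fin n) ℂ), FiniteDimensional ℂ W →
      Module.finrank ℂ W ≤ r → (∀ ρ : Perm (Fin n), ∀ w ∈ W, ren ρ w ∈ W) →
        W ≤ Submodule.span ℂ {v | v ∈ W ∧ ∃ Y : Finset (Fin n), Y.card ≤ k ∧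
          ∀ ρ : Perm (Fin n), (∀ i ∈ Y, ρ i = i) → Perm.sign ρ = 1 → ren ρ v = v})
    {f : MvPolynomial (Fin n × Fin n) ℂ} (hdeg : f.totalDegree ≤ D)
    (hrank : ∀ e m, FiniteDimensional ℂ (derivChain (homogeneousComponent e f) m) ∧
      Module.finrank ℂ (derivChain (homogeneousComponent e f) m) ≤ r)
    (hsym : ∀ ρ : Perm (Fin n), ren ρ f = f) :
    QPOrbitRestorable (k + 7) n f := by
  set fc : ℕ → MvPolynomial (Fin n × Fin n) ℂ := fun e => homogeneousComponent e f with hfc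
  have hfc_sym : ∀ e, ∀ ρ : Perm (Fin n), mact ρ ρ (fc e) = fc e := fun e ρ => by
    rw [hfc]; simp only []; rw [mact_homogeneousComponent, ← ren_eq_mact, hsym]
  -- alt-supported spanning sets for each component's derivative chain
  have hfin : ∀ e m, ∃ T : Finset (MvPolynomial (Fin n × Fin n) ℂ),
      (∀ t ∈ T, t ∈ derivChain (fc e) m ∧ ∃ Y : Finset (Fin n), Y.card ≤ k ∧
        ∀ ρ : Perm (Fin n), (∀ i ∈ Y, ρ i = i) → Perm.sign ρ = 1 → ren ρ t = t) ∧
      derivChain (fc e) m ≤ Submodule.span ℂ (T : Set _) := by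
    intro e m
    have hrk := hrank e m
    haveI := hrk.1
    have hspan := hKey _ hrk.1 hrk.2 (fun ρ v hv => by
      rw [ren_eq_mact]; exact mact_mem_derivChain_of_fixed (hfc_sym e ρ) m hv)
    obtain ⟨S₀, hS₀⟩ := (Submodule.fg_iff_finiteDimensional _).2 hrk.1
    have hch : ∀ s ∈ S₀, ∃ F : Finset (MvPolynomial (Fin n × Fin n) ℂ),
        (↑F : Set _) ⊆ {v | v ∈ derivChain (fc e) m ∧ ∃ Y : Finset (Fin n), Y.card ≤ k ∧
          ∀ ρ : Perm (Fin n), (∀ i ∈ Y, ρ i = i) → Perm.sign ρ = 1 → ren ρ v = v} ∧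
        s ∈ Submodule.span ℂ (F : Set _) := by
      intro s hs
      have hs' : s ∈ derivChain (fc e) m := by rw [← hS₀]; exact Submodule.subset_span hs
      exact Submodule.mem_span_finite_of_mem_span (hspan hs')
    choose F hF using hch
    refine ⟨S₀.attach.biUnion fun s => F s.1 s.2, fun t ht => ?_, ?_⟩
    · obtain ⟨s, -, hts⟩ := Finset.mem_biUnion.mp ht
      exact (hF s.1 s.2).1 hts
    · rw [← hS₀, Submodule.span_le]
      intro s hs
      refine Submodule.span_mono ?_ (hF s hs).2
      intro v hv
      simp only [Finset.coe_biUnion, Finset.coe_attach, Set.mem_univ, Set.iUnion_true, Set.mem_iUnion]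
      exact ⟨⟨s, hs⟩, hv⟩
  choose T hT using hfin
  -- the graded system: values of degree `g` are the levels `e - g` of the chains of `fc e`, `g ≤ e ≤ D`
  let V : ℕ → Finset (MvPolynomial (Fin n × Fin n) ℂ) := fun g =>
    (Finset.range (D + 1)).biUnion fun e => if g ≤ e then T e (e - g) else ∅
  have hVmem : ∀ g t, t ∈ V g ↔ ∃ e, e ≤ D ∧ g ≤ e ∧ t ∈ T e (e - g) := by
    intro g t
    simp only [V, Finset.mem_biUnion, Finset.mem_range]
    constructor
    · rintro ⟨e, he, ht⟩
      by_cases hge : g ≤ e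
      · rw [if_pos hge] at ht; exact ⟨e, by omega, hge, ht⟩
      · rw [if_neg hge] at ht; exact absurd ht (Finset.notMem_empty t)
    · rintro ⟨e, he, hge, ht⟩
      exact ⟨e, by omega, by rw [if_pos hge]; exact ht⟩
  have hhomV : ∀ g, ∀ t ∈ V g, t.IsHomogeneous g := by
    intro g t ht
    obtain ⟨e, -, hge, ht⟩ := (hVmem g t).1 ht
    have h := isHomogeneous_of_mem_derivChain_of_isHomogeneous (homogeneousComponent_isHomogeneous e f)
      (e - g) ((hT e (e - g)).1 t ht).1
    rwa [show e - (e - g) = g by omega] at h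
  have hsuppV : ∀ g, ∀ t ∈ V g, ∃ Y : Finset (Fin n), Y.card ≤ k ∧
      ∀ ρ : Perm (Fin n), (∀ i ∈ Y, ρ i = i) → Perm.sign ρ = 1 → ren ρ t = t := by
    intro g t ht
    obtain ⟨e, -, -, ht⟩ := (hVmem g t).1 ht
    exact ((hT e (e - g)).1 t ht).2
  have hderV : ∀ g, ∀ t ∈ V (g + 1), ∀ x : Fin n × Fin n,
      pderiv x t ∈ Submodule.span ℂ (V g : Set (MvPolynomial (Fin n × Fin n) ℂ)) := by
    intro g t ht x
    obtain ⟨e, he, hge, ht⟩ := (hVmem (g + 1) t).1 ht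
    have h1 : pderiv x t ∈ derivChain (fc e) (e - (g + 1) + 1) :=
      pderiv_mem_derivChain ((hT e (e - (g + 1))).1 t ht).1 x
    rw [show e - (g + 1) + 1 = e - g by omega] at h1
    refine Submodule.span_mono ?_ ((hT e (e - g)).2 h1)
    intro v hv
    exact (hVmem g v).2 ⟨e, he, by omega, hv⟩
  -- `f` is the sum of its components, each a value of the system
  have hfsum : f = ∑ e ∈ Finset.range (D + 1), fc e := by
    conv_lhs => rw [← sum_homogeneousComponent f]
    have hsub : Finset.range (f.totalDegree + 1) ⊆ Finset.range (D + 1) :=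
      fun x hx => Finset.mem_range.2 (by rw [Finset.mem_range] at hx; omega)
    rw [← Finset.sum_subset hsub]
    intro e he hne
    rw [Finset.mem_range] at he hne
    show homogeneousComponent e f = 0
    exact homogeneousComponent_eq_zero e f (by omega)
  have hfspan : f ∈ Submodule.span ℂ (((Finset.range (D + 1)).biUnion V : Finset _) :
      Set (MvPolynomial (Fin n × Fin n) ℂ)) := by
    rw [hfsum]
    refine Submodule.sum_mem _ fun e he => ?_
    rw [Finset.mem_range] at he
    have h0 : fc e ∈ derivChain (fc e) 0 := mem_derivChain_zero _
    refine Submodule.span_mono ?_ ((hT e (e - e)).2 (by rw [Nat.sub_self]; exact h0))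
    intro v hv
    rw [Finset.mem_coe, Finset.mem_biUnion]
    exact ⟨e, Finset.mem_range.2 he, (hVmem e v).2 ⟨e, by omega, le_rfl, hv⟩⟩
  exact DerivativeTowerAlt.qpOrbitRestorable_of_gradedSystem (D := D) V hhomV hsuppV hderV hfspan hsym

/-- **GRADED POLYNOMIAL CATALECTICANT RANK ⇒ RESTORATION, DIAGONAL FAMILY FORM, ONE CONSTANT.**  For every `c` there is `c'`
such that every DIAGONALLY invariant family `f` (`ren ρ (f n) = f n` for all `n, ρ`) all of whose homogeneous components have
every derivative space of dimension `≤ n^c + c` satisfies `QPOrbitRestorable c' n (f n)` for every `n`. [folklore] -/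
theorem smallGradedDerivChain_restoration_diag (c : ℕ) : ∃ c' : ℕ,
    ∀ f : (n : ℕ) → MvPolynomial (Fin n × Fin n) ℂ, (∀ (n : ℕ) (ρ : Perm (Fin n)), ren ρ (f n) = f n) →
      (∀ n e m, FiniteDimensional ℂ (derivChain (homogeneousComponent e (f n)) m) ∧
        Module.finrank ℂ (derivChain (homogeneousComponent e (f n)) m) ≤ n ^ c + c) →
      ∀ n : ℕ, QPOrbitRestorable c' n (f n) := by
  obtain ⟨k, n₀, hk⟩ := AltFix.smallModules_altSpanning c
  refine ⟨n₀.factorial + k + 7, fun f hsym hrank n => ?_⟩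
  by_cases hn : n₀ ≤ n
  · exact Restorable.qpOrbitRestorable_mono (by omega)
      (qpOrbitRestorable_of_smallGradedDerivChain_diag (k := k) (r := n ^ c + c) (D := (f n).totalDegree)
        (fun W hW hdim hst => hk n hn W hW hdim hst) le_rfl (hrank n) (hsym n))
  · refine Restorable.qpOrbitRestorable_mono ?_ (Restorable.qpOrbitRestorable_of_invariant (f n) (hsym n))
    have : n.factorial ≤ n₀.factorial := Nat.factorial_le (by omega)
    omega

/-- **POLYNOMIAL CATALECTICANT RANK ⇒ RESTORATION, DIAGONAL FAMILY FORM.** [folklore] -/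
theorem catalecticant_restoration_diag (c : ℕ) : ∃ c' : ℕ,
    ∀ f : (n : ℕ) → MvPolynomial (Fin n × Fin n) ℂ, (∀ (n : ℕ) (ρ : Perm (Fin n)), ren ρ (f n) = f n) →
      (∀ n m, FiniteDimensional ℂ (derivChain (f n) m) ∧ Module.finrank ℂ (derivChain (f n) m) ≤ n ^ c + c) →
      ∀ n : ℕ, QPOrbitRestorable c' n (f n) := by
  obtain ⟨c', hc'⟩ := smallGradedDerivChain_restoration_diag c
  refine ⟨c', fun f hsym hrank n => hc' f hsym (fun n e m => ?_) n⟩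
  haveI := (hrank n m).1
  have h := finrank_derivChain_homogeneousComponent_le (f n) e m
  exact ⟨h.1, h.2.trans (hrank n m).2⟩

/-- **BOX-VOLUME RESTORATION, DIAGONAL FAMILY FORM.** [folklore] -/
theorem boxVolume_restoration_diag (c : ℕ) : ∃ c' : ℕ,
    ∀ f : (n : ℕ) → MvPolynomial (Fin n × Fin n) ℂ, (∀ (n : ℕ) (ρ : Perm (Fin n)), ren ρ (f n) = f n) →
      (∀ n : ℕ, ∃ (k : ℕ) (t : Fin k → ℕ) (a : Fin k → ℂ) (w : (i : Fin k) → Fin (t i) → (Fin n × Fin n) → ℂ)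
        (b : (i : Fin k) → Fin (t i) → ℂ) (e : (i : Fin k) → Fin (t i) → ℕ),
          (∑ i, ∏ j, (e i j + 1)) ≤ n ^ c + c ∧
          f n = ∑ i, C (a i) * ∏ j, (lin (w i j) + C (b i j)) ^ (e i j)) →
      ∀ n : ℕ, QPOrbitRestorable c' n (f n) := by
  obtain ⟨c', hc'⟩ := catalecticant_restoration_diag c
  refine ⟨c', fun f hsym hf n => hc' f hsym (fun n m => ?_) n⟩
  obtain ⟨k, t, a, w, b, e, hvol, hfn⟩ := hf n
  have h := finrank_derivChain_boxSum_le' t a w b e m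
  rw [← hfn] at h
  exact ⟨h.1, h.2.trans hvol⟩

/-! ### Per level -/

/-- **THE BOX-VOLUME STRATUM PER LEVEL, DIAGONAL INVARIANCE ONLY (uniform constant).**  For every `c` there is `c'` such that
every DIAGONALLY invariant `p` at level `n` with a representation `p = Σ_{i<k} C(a i) · Π (L i)` (every `L i` a multiset of
polynomials of total degree `≤ 1`) of total box volume `Σ_i Π_{ℓ ∈ (L i).toFinset} (count ℓ + 1) ≤ n^c + c` is
`QPOrbitRestorable c' n p` (singleton-family trick on `boxVolume_restoration_diag`). [folklore] -/
theorem qpOrbitRestorable_of_smallBox_diag (c : ℕ) : ∃ c' : ℕ, ∀ (n : ℕ) (p : MvPolynomial (Fin n × Fin n) ℂ),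
    (∀ ρ : Perm (Fin n), ren ρ p = p) →
    (∃ (k : ℕ) (a : Fin k → ℂ) (L : Fin k → Multiset (MvPolynomial (Fin n × Fin n) ℂ)),
      (∀ i, ∀ ℓ ∈ L i, ℓ.totalDegree ≤ 1) ∧
      (∑ i, ∏ ℓ ∈ (L i).toFinset, ((L i).count ℓ + 1)) ≤ n ^ c + c ∧
      p = ∑ i, C (a i) * (L i).prod) →
    QPOrbitRestorable c' n p := by
  obtain ⟨c', hc'⟩ := boxVolume_restoration_diag c
  refine ⟨c', fun n p hp hrep => ?_⟩
  obtain ⟨k, a, L, hdeg, hvol, hpL⟩ := hrep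
  set F : (m : ℕ) → MvPolynomial (Fin m × Fin m) ℂ :=
    Function.update (fun m => (0 : MvPolynomial (Fin m × Fin m) ℂ)) n p with hF
  have hFn : F n = p := by simp [hF]
  have hFm : ∀ m, m ≠ n → F m = 0 := fun m hm => by simp [hF, Function.update_of_ne hm]
  have hFsym : ∀ (m : ℕ) (ρ : Perm (Fin m)), ren ρ (F m) = F m := by
    intro m ρ
    by_cases h : m = n
    · subst h; rw [hFn]; exact hp ρ
    · rw [hFm m h, map_zero]
  have key := hc' F hFsym ?_ n
  · rwa [hFn] at key
  intro m
  by_cases h : m = n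
  · subst h
    have hbox := fun i => exists_boxForm (L i) (hdeg i)
    choose t w b e hprod hcount using hbox
    refine ⟨k, t, a, w, b, e, ?_, ?_⟩
    · calc (∑ i, ∏ j, (e i j + 1)) = ∑ i, ∏ ℓ ∈ (L i).toFinset, ((L i).count ℓ + 1) :=
            Finset.sum_congr rfl fun i _ => hcount i
        _ ≤ m ^ c + c := hvol
    · rw [hFn, hpL]
      exact Finset.sum_congr rfl fun i _ => by rw [hprod i]
  · refine ⟨0, Fin.elim0, Fin.elim0, fun i => Fin.elim0 i, fun i => Fin.elim0 i, fun i => Fin.elim0 i, ?_, ?_⟩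
    · simp
    · rw [hFm m h]; simp

end DerivativeTower

end Summit.ValiantsHypothesis.ValiantsHypothesis.Theorems

end
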